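import Summits.PneNP.PneNP.Theorems.ChebyshevTracialDesignCrossingPlaneReduction
import Summits.PneNP.PneNP.Theorems.ChebyshevTracialDesignVirtualPositivityCriterion
import Literature.Combinatorics.Optimization.ShellLawMixedPinning
import HarnessLib

/-!
# Cell pnp-psdrank, route `ChebyshevTracialDesign`: tools for the γ-direction pinning reduction (crux `TracialDecayExp20`,
# stmt-PneNP-19878)

Brick 129a (prover g26; MEMO-28 §3c line (L-b), MEMO-29). Outside the crossing plane the (CG_1′) containment form of an
`H`-symmetric mask at a matching `M` is `ψ(|U∩H|)·(2γ·n_A(U) + 2λ(X − Y) + κ(t − c))²` (`n_A(U)` = number of `HH` edges of `M`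
inside `U`, Literature `gammaWeight_containment_eq`). Pinning full `HH` edges (Literature `ShellLawFullEdgeMoments`,
`ShellLawMixedPinning`) writes the level profiles of `ψ·n_A`, `ψ·n_A(n_A−1)`, `ψ·n_A·Y` as (polynomial in the level `c`) × (block-statistic
profiles on ground sets with one or two edges deleted). This file supplies the calculus and the smoothness bookkeeping the reduction
(brick 129, next file) needs:

* §1 difference calculus: `fwdDiff_iter_one_congr_of_le` (`Δ^k f(y)` only sees `f(y), …, f(y+k)`), **`fwdDiff_iter_affMul`** (Leibniz for an
  affine node factor: `Δ^k[(A − 2j)·g](y) = (A − 2y)·Δ^k g(y) − 2k·Δ^{k−1}g(y+1)`) and its bound, `newtonPolyOdd_eval_zero_add` (the virtual value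
  is additive in the profile).
* §2 **`abs_fwdDiff_iter_subProfile_le`** — ONE smoothness lemma for block-statistic profiles on an arbitrary `π`-stable sub-ground set
  `S ⊆ [n]` with `|S| + 2r = n` (bricks 117 §1 / 119 §2 / 119b §2 are the cases `S = [n]`, `[n] ∖ e_v`, `[n] ∖ e_v ∖ e_w`): for `|χ| ≤ G` on `[0, t′+2k]`,
  `Shell_S(t′+2k, c′+2k) ≠ ∅`, `m ≥ 3`, `m + 4k + 2r ≤ n`, and the `x`-smoothness number `X` of the `k`-fold deleted shell laws on the `π`-stable `S′`
  with `|S′| + 4k + 2r = n`: `|Δ^k_{(2)}[c ↦ E_{Shell_S(t′+2k,c)}[χ(|W∩H|)]](c′)| ≤ G·ρ^k·X`, `ρ = m/(4(m−2))`; and its three instances used by the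
  reduction: `abs_fwdDiff_iter_pin1Profile_le` (one full edge deleted, odd cut), `abs_fwdDiff_iter_pin2Profile_le` (two full edges, odd cut),
  `abs_fwdDiff_iter_pin11Profile_le` (one full edge and one half-matched vertex, even cut) — nonemptiness imported from the shells of `M`.
* §3 the three pinned AVERAGE identities at a matching on the full ground set (`|[n]| = n`): `shellAvg_hhCount_eq`
  (`E_c[χ(X)·n_A] = ((t−c)/n)·Σ_{v∈reps(vAA)} E_{Shell_{[n]∖e_v}(t−2,c)}[χ(X′+2)]`), `shellAvg_hhPairs_eq`
  (`E_c[ψ(X)·n_A(n_A−1)] = ((t−c)(t−2−c)/(n(n−2)))·Σ_{v≠w} E_{Shell_{[n]∖e_v∖e_w}(t−4,c)}[ψ(X″+4)]`), `shellAvg_hhCount_halfCount_eq`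
  (`E_c[ψ(X)·n_A·Y] = ((t−c)·c/(n(n−2)))·Σ_vΣ_{w∈([n]∖e_v)∩H} E_{Shell_{[n]∖e_v∖e_w}(t−3,c−1)}[ψ(X+3)]`).

WHAT THIS FILE DOES NOT DO: bound any design value (brick 129), bound the `X_k` (bricks 118/125), sign a virtual value ((O1)/(O3)),
anything on `TracialDecayExp20` itself, psd rank of P_PM(K_n), or P vs NP.
[cite: Rothvoss2017, §2 (PDF p. 6)] [cite: Boole2009, Ch. II Art. 10 Ex. 3 eq. (8) (PDF pp. 34–35)]
[cite: Agarwal2000DifferenceEquations, Thm. 1.8.5 (1.8.6)] [cite: RollinRoss2010, §3 (Lemma 3.1)]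
Stature: support/instrument (kernel lane, no defs, axioms standard). Supports stmt-PneNP-19878.
-/

set_option linter.dupNamespace false -- `Summit.PneNP.PneNP.…`: summit = sub-problem (D-0017)

noncomputable section

namespace Summit.PneNP.PneNP.Theorems.ChebyshevTracialDesignGammaDirectionTools

open Finset Polynomial Literature.Barriers.PneNP Literature.Combinatorics.Optimization
open Literature.Combinatorics.Optimization.ShellStep
open Summit.PneNP.PneNP.Theorems.ChebyshevTracialDesignShellOperatorForm (shell_partner_nonempty)
open Summit.PneNP.PneNP.Theorems.ChebyshevTracialDesignBlockStatisticPricing (pairs_hyp rho_nonneg)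
open Summit.PneNP.PneNP.Theorems.ChebyshevTracialDesignHalfPinnedNull (fwdDiff_iter_levelMul)
open Summit.PneNP.PneNP.Theorems.ChebyshevTracialDesignVirtualPositivityCriterion (newtonPolyOdd_eval_zero_eq_sum_fwdDiff)

variable {n : ℕ}

/-! ### §1 Difference calculus: initial segments, affine node factors, additivity of the virtual value -/

/-- `Δ^k f(y)` depends only on `f(y), …, f(y+k)`. [cite: Agarwal2000DifferenceEquations, Thm. 1.8.5 (1.8.6)] -/
theorem fwdDiff_iter_one_congr_of_le (k : ℕ) {f g : ℕ → ℝ} {y : ℕ} (h : ∀ i, i ≤ k → f (y + i) = g (y + i)) :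
    (fwdDiff (1 : ℕ))^[k] f y = (fwdDiff (1 : ℕ))^[k] g y := by
  rw [fwdDiff_iter_eq_sum_shift, fwdDiff_iter_eq_sum_shift]
  refine sum_congr rfl fun i hi => ?_
  rw [smul_eq_mul, mul_one, h i (Nat.lt_succ_iff.1 (mem_range.1 hi))]

/-- **Leibniz for an affine node factor**: `Δ^k[(A − 2j)·g(j)](y) = (A − 2y)·Δ^k g(y) − 2k·Δ^{k−1} g(y+1)`
(`A − 2j = (A+1) − (2j+1)` and brick 119's `fwdDiff_iter_levelMul`). [cite: Boole2009, Ch. II Art. 10 Ex. 3 eq. (8) (PDF pp. 34–35)] -/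
theorem fwdDiff_iter_affMul (A : ℝ) (g : ℕ → ℝ) (k y : ℕ) :
    (fwdDiff (1 : ℕ))^[k] (fun j : ℕ => (A - 2 * (j : ℝ)) * g j) y =
      (A - 2 * (y : ℝ)) * (fwdDiff (1 : ℕ))^[k] g y - 2 * (k : ℝ) * (fwdDiff (1 : ℕ))^[k - 1] g (y + 1) := by
  have hsplit : (fun j : ℕ => (A - 2 * (j : ℝ)) * g j) =
      ((A + 1) • g) + ((-1 : ℝ) • (fun j : ℕ => (2 * (j : ℝ) + 1) * g j)) := by
    funext j; simp only [Pi.add_apply, Pi.smul_apply, smul_eq_mul]; ring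
  rw [hsplit, fwdDiff_iter_add, fwdDiff_iter_const_smul, fwdDiff_iter_const_smul, Pi.add_apply, Pi.smul_apply,
    Pi.smul_apply, smul_eq_mul, smul_eq_mul, fwdDiff_iter_levelMul]
  ring

/-- Bound for the affine Leibniz rule: if `|A − 2y| ≤ B` then `|Δ^k[(A − 2j)g](y)| ≤ B·|Δ^k g(y)| + 2k·|Δ^{k−1}g(y+1)|`.
[cite: Boole2009, Ch. II Art. 10 Ex. 3 eq. (8) (PDF pp. 34–35)] -/
theorem abs_fwdDiff_iter_affMul_le {A B : ℝ} (g : ℕ → ℝ) (k y : ℕ) (hA : |A - 2 * (y : ℝ)| ≤ B) :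
    |(fwdDiff (1 : ℕ))^[k] (fun j : ℕ => (A - 2 * (j : ℝ)) * g j) y| ≤
      B * |(fwdDiff (1 : ℕ))^[k] g y| + 2 * (k : ℝ) * |(fwdDiff (1 : ℕ))^[k - 1] g (y + 1)| := by
  rw [fwdDiff_iter_affMul]
  calc |(A - 2 * (y : ℝ)) * (fwdDiff (1 : ℕ))^[k] g y - 2 * (k : ℝ) * (fwdDiff (1 : ℕ))^[k - 1] g (y + 1)|
      ≤ |(A - 2 * (y : ℝ)) * (fwdDiff (1 : ℕ))^[k] g y| + |2 * (k : ℝ) * (fwdDiff (1 : ℕ))^[k - 1] g (y + 1)| :=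
        abs_sub _ _
    _ ≤ B * |(fwdDiff (1 : ℕ))^[k] g y| + 2 * (k : ℝ) * |(fwdDiff (1 : ℕ))^[k - 1] g (y + 1)| := by
        rw [abs_mul, abs_mul, abs_of_nonneg (by positivity : (0 : ℝ) ≤ 2 * (k : ℝ))]
        gcongr

/-- **Additivity of the virtual value**: `N^{odd}_D[φ₁ + φ₂](0) = N^{odd}_D[φ₁](0) + N^{odd}_D[φ₂](0)`.
[cite: Agarwal2000DifferenceEquations, Thm. 1.8.5 (1.8.6)] -/
theorem newtonPolyOdd_eval_zero_add (D : ℕ) (φ₁ φ₂ : ℕ → ℝ) :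
    (DesignRemainder.newtonPolyOdd D (fun c => φ₁ c + φ₂ c)).eval 0 =
      (DesignRemainder.newtonPolyOdd D φ₁).eval 0 + (DesignRemainder.newtonPolyOdd D φ₂).eval 0 := by
  rw [newtonPolyOdd_eval_zero_eq_sum_fwdDiff, newtonPolyOdd_eval_zero_eq_sum_fwdDiff, newtonPolyOdd_eval_zero_eq_sum_fwdDiff,
    ← sum_add_distrib]
  refine sum_congr rfl fun k _ => ?_
  have h : (fun j => φ₁ (2 * j + 1) + φ₂ (2 * j + 1)) = (fun j => φ₁ (2 * j + 1)) + (fun j => φ₂ (2 * j + 1)) := by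
    funext j; rfl
  rw [h, fwdDiff_iter_add, Pi.add_apply]
  ring

/-! ### §2 Level differences of block-statistic profiles on a sub-ground set -/

/-- **Level differences of a block-statistic profile on a `π`-stable sub-ground set.** For a perfect matching `M` (partner map `π`),
a `π`-stable `S` with `|S| + 2r = n`, a block `H`, `|χ| ≤ G` on `[0, t′+2k]`, a level `c′` with `Shell_S(t′+2k, c′+2k) ≠ ∅`, `m ≥ 3`,
`m + 4k + 2r ≤ n`: if every `π`-stable `S′` with `|S′| + 4k + 2r = n` has `Σ_{x=0}^{t′+2k} |(∇²)^k law_{S′}(t′,·)(c′)(x)| ≤ X`, then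
`|Δ^k_{(2)}[c ↦ E_{Shell_S(t′+2k,c)}[χ(|W∩H|)]](c′)| ≤ G·ρ^k·X`, `ρ = m/(4(m−2))` (Literature iterated `ℓ¹` bound on `S`).
[cite: Rothvoss2017, §2 (PDF p. 6)] [cite: RollinRoss2010, §3 (Lemma 3.1)] -/
theorem abs_fwdDiff_iter_subProfile_le (M : PMatch n) {S : Finset (Fin n)} (hS : ∀ u ∈ S, M.2.partner u ∈ S)
    {r : ℕ} (hScard : S.card + 2 * r = n) (H : Finset (Fin n)) (χ : ℤ → ℝ) {G : ℝ} (hG0 : 0 ≤ G)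
    {t' k c' m : ℕ} (hG : ∀ x ∈ Icc (0 : ℤ) ((t' + 2 * k : ℕ) : ℤ), |χ x| ≤ G)
    (hne : (shellIn M.2.partner S (t' + 2 * k) (c' + 2 * k)).Nonempty) (hm : 3 ≤ m) (hmn : m + 4 * k + 2 * r ≤ n)
    {X : ℝ} (hX0 : 0 ≤ X)
    (hX : ∀ S' : Finset (Fin n), (∀ u ∈ S', M.2.partner u ∈ S') → S'.card + 4 * k + 2 * r = n →
      ∑ x ∈ Icc (0 : ℤ) ((t' + 2 * k : ℕ) : ℤ),
        |nab2^[k] (fun c x => shellLaw M.2.partner S' H t' c x : Profile) c' x| ≤ X) :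
    |((fwdDiff (2 : ℕ))^[k] (fun c => (∑ W ∈ shellIn M.2.partner S (t' + 2 * k) c, χ ((W ∩ H).card : ℤ)) /
        ((shellIn M.2.partner S (t' + 2 * k) c).card : ℝ))) c'| ≤
      G * (((m : ℝ) / (4 * ((m : ℝ) - 2))) ^ k * X) := by
  set π := M.2.partner with hπdef
  have hπ : ∀ v, π (π v) = v := partner_partner M
  have hπ' : ∀ v, π v ≠ v := partner_ne M
  refine (abs_fwdDiff_iter_shellInAvg_le S H (t' + 2 * k) k c' χ hG).trans (mul_le_mul_of_nonneg_left ?_ hG0)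
  have hρ0 : (0 : ℝ) ≤ (m : ℝ) / (4 * ((m : ℝ) - 2)) := rho_nonneg hm
  have h := sum_abs_nab2_iter_fwdDiff_iter_le hπ hπ' H t' (Icc (0 : ℤ) ((t' + 2 * k : ℕ) : ℤ)) hρ0 hX0 k 0 hS c' hne
    (fun S' _ hS' hlt => pairs_hyp hπ H hm S' hS' (by omega))
    (fun S' _ hS' heq => by
      rw [zero_add]
      exact hX S' hS' (by omega))
  simpa using h

/-- **One full edge deleted** (`S = [n] ∖ e_v`, odd cut `t₀ = t₀′ + 2k`, odd level `c′`, `c′ + 2k + 2 ≤ t₀ + 2`, `t₀ + 2 + (c′+2k) ≤ n`): the deleted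
shell is nonempty because the shell of `M` two sizes up is and has a full edge. [cite: Rothvoss2017, §2 (PDF p. 6)] [cite: RollinRoss2010, §3 (Lemma 3.1)] -/
theorem abs_fwdDiff_iter_pin1Profile_le (M : PMatch n) (v : Fin n) (H : Finset (Fin n)) (χ : ℤ → ℝ) {G : ℝ} (hG0 : 0 ≤ G)
    {t₀' k c' m : ℕ} (hG : ∀ x ∈ Icc (0 : ℤ) ((t₀' + 2 * k : ℕ) : ℤ), |χ x| ≤ G)
    (ht : Odd (t₀' + 2 * k)) (hc : Odd c') (hct : c' + 2 * k + 2 ≤ t₀' + 2 * k + 2) (hn : t₀' + 2 * k + 2 + (c' + 2 * k) ≤ n)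
    (hm : 3 ≤ m) (hmn : m + 4 * k + 2 ≤ n) {X : ℝ} (hX0 : 0 ≤ X)
    (hX : ∀ S' : Finset (Fin n), (∀ u ∈ S', M.2.partner u ∈ S') → S'.card + 4 * k + 2 = n →
      ∑ x ∈ Icc (0 : ℤ) ((t₀' + 2 * k : ℕ) : ℤ),
        |nab2^[k] (fun c x => shellLaw M.2.partner S' H t₀' c x : Profile) c' x| ≤ X) :
    |((fwdDiff (2 : ℕ))^[k] (fun c => (∑ W ∈ shellIn M.2.partner (univ \ {v, M.2.partner v}) (t₀' + 2 * k) c,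
        χ ((W ∩ H).card : ℤ)) / ((shellIn M.2.partner (univ \ {v, M.2.partner v}) (t₀' + 2 * k) c).card : ℝ))) c'| ≤
      G * (((m : ℝ) / (4 * ((m : ℝ) - 2))) ^ k * X) := by
  set π := M.2.partner with hπdef
  have hπ : ∀ v, π (π v) = v := partner_partner M
  have hπ' : ∀ v, π v ≠ v := partner_ne M
  have hU : ∀ u ∈ (univ : Finset (Fin n)), π u ∈ (univ : Finset (Fin n)) := fun u _ => mem_univ _
  have hS : ∀ u ∈ univ \ {v, π v}, π u ∈ univ \ {v, π v} := sdiff_pair_stable hπ hU v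
  have hScard : (univ \ {v, π v} : Finset (Fin n)).card + 2 * 1 = n := by
    have := card_sdiff_pair hπ' hU (mem_univ v)
    rw [card_univ, Fintype.card_fin] at this
    omega
  have hne : (shellIn π (univ \ {v, π v}) (t₀' + 2 * k) (c' + 2 * k)).Nonempty := by
    refine shellIn_sdiff_pair_nonempty_of_full hπ hπ' hU (mem_univ v) ?_ (by omega)
    rw [shellIn_univ]
    exact shell_partner_nonempty M (by obtain ⟨i, hi⟩ := ht; exact ⟨i + 1, by omega⟩)
      (by obtain ⟨i, hi⟩ := hc; exact ⟨i + k, by omega⟩) (by omega) (by omega)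
  exact abs_fwdDiff_iter_subProfile_le M hS hScard H χ hG0 hG hne hm (by omega) hX0 hX

/-- **Two full edges deleted** (`S = [n] ∖ e_v ∖ e_w`, `w ∉ e_v`, odd cut `t₀ = t₀′ + 2k`, odd level `c′`, `c′ + 2k + 4 ≤ t₀ + 4`,
`t₀ + 4 + (c′+2k) ≤ n`). [cite: Rothvoss2017, §2 (PDF p. 6)] [cite: RollinRoss2010, §3 (Lemma 3.1)] -/
theorem abs_fwdDiff_iter_pin2Profile_le (M : PMatch n) {v w : Fin n} (hwv : w ≠ v) (hwπ : w ≠ M.2.partner v)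
    (H : Finset (Fin n)) (χ : ℤ → ℝ) {G : ℝ} (hG0 : 0 ≤ G)
    {t₀' k c' m : ℕ} (hG : ∀ x ∈ Icc (0 : ℤ) ((t₀' + 2 * k : ℕ) : ℤ), |χ x| ≤ G)
    (ht : Odd (t₀' + 2 * k)) (hc : Odd c') (hct : c' + 2 * k + 4 ≤ t₀' + 2 * k + 4) (hn : t₀' + 2 * k + 4 + (c' + 2 * k) ≤ n)
    (hm : 3 ≤ m) (hmn : m + 4 * k + 4 ≤ n) {X : ℝ} (hX0 : 0 ≤ X)
    (hX : ∀ S' : Finset (Fin n), (∀ u ∈ S', M.2.partner u ∈ S') → S'.card + 4 * k + 4 = n →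
      ∑ x ∈ Icc (0 : ℤ) ((t₀' + 2 * k : ℕ) : ℤ),
        |nab2^[k] (fun c x => shellLaw M.2.partner S' H t₀' c x : Profile) c' x| ≤ X) :
    |((fwdDiff (2 : ℕ))^[k] (fun c => (∑ W ∈ shellIn M.2.partner (del2 M.2.partner univ v w) (t₀' + 2 * k) c,
        χ ((W ∩ H).card : ℤ)) / ((shellIn M.2.partner (del2 M.2.partner univ v w) (t₀' + 2 * k) c).card : ℝ))) c'| ≤
      G * (((m : ℝ) / (4 * ((m : ℝ) - 2))) ^ k * X) := by
  set π := M.2.partner with hπdef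
  have hπ : ∀ v, π (π v) = v := partner_partner M
  have hπ' : ∀ v, π v ≠ v := partner_ne M
  have hU : ∀ u ∈ (univ : Finset (Fin n)), π u ∈ (univ : Finset (Fin n)) := fun u _ => mem_univ _
  have hS : ∀ u ∈ del2 π univ v w, π u ∈ del2 π univ v w := del2_stable hπ hU v w
  have hScard : (del2 π univ v w).card + 2 * 2 = n := by
    have := card_del2_add_four hπ hπ' hU (mem_univ v) (mem_univ w) hwv hwπ
    rw [card_univ, Fintype.card_fin] at this
    omega
  have hS1 : ∀ u ∈ univ \ {v, π v}, π u ∈ univ \ {v, π v} := sdiff_pair_stable hπ hU v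
  have hw' : w ∈ (univ : Finset (Fin n)) \ {v, π v} := by
    rw [mem_sdiff, mem_insert, mem_singleton, not_or]; exact ⟨mem_univ _, hwv, hwπ⟩
  have hne : (shellIn π (del2 π univ v w) (t₀' + 2 * k) (c' + 2 * k)).Nonempty := by
    rw [del2_eq_sdiff_sdiff]
    refine shellIn_sdiff_pair_nonempty_of_full hπ hπ' hS1 hw' ?_ (by omega)
    refine shellIn_sdiff_pair_nonempty_of_full hπ hπ' hU (mem_univ v) ?_ (by omega)
    rw [shellIn_univ]
    exact shell_partner_nonempty M (by obtain ⟨i, hi⟩ := ht; exact ⟨i + 2, by omega⟩)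
      (by obtain ⟨i, hi⟩ := hc; exact ⟨i + k, by omega⟩) (by omega) (by omega)
  exact abs_fwdDiff_iter_subProfile_le M hS hScard H χ hG0 hG hne hm (by omega) hX0 hX

/-- **One full edge and one half-matched vertex deleted** (`S = ([n] ∖ e_v) ∖ e_w`, `w ∉ e_v`, EVEN cut `t₀ = t₀′ + 2k` with `t₀ + 3` odd, even level
`c′`, `c′ + 2k + 3 ≤ t₀ + 3`, `t₀ + 3 + (c′ + 2k + 1) ≤ n`): nonempty via one full pin and one half pin from the shell of `M` at `(t₀+3, c′+2k+1)`.
[cite: Rothvoss2017, §2 (PDF p. 6)] [cite: RollinRoss2010, §3 (Lemma 3.1)] -/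
theorem abs_fwdDiff_iter_pin11Profile_le (M : PMatch n) {v w : Fin n} (hw : w ∈ (univ : Finset (Fin n)) \ {v, M.2.partner v})
    (H : Finset (Fin n)) (χ : ℤ → ℝ) {G : ℝ} (hG0 : 0 ≤ G)
    {t₀' k c' m : ℕ} (hG : ∀ x ∈ Icc (0 : ℤ) ((t₀' + 2 * k : ℕ) : ℤ), |χ x| ≤ G)
    (ht : Odd (t₀' + 2 * k + 3)) (hc : Even c') (hct : c' + 2 * k + 3 ≤ t₀' + 2 * k + 3)
    (hn : t₀' + 2 * k + 3 + (c' + 2 * k + 1) ≤ n)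
    (hm : 3 ≤ m) (hmn : m + 4 * k + 4 ≤ n) {X : ℝ} (hX0 : 0 ≤ X)
    (hX : ∀ S' : Finset (Fin n), (∀ u ∈ S', M.2.partner u ∈ S') → S'.card + 4 * k + 4 = n →
      ∑ x ∈ Icc (0 : ℤ) ((t₀' + 2 * k : ℕ) : ℤ),
        |nab2^[k] (fun c x => shellLaw M.2.partner S' H t₀' c x : Profile) c' x| ≤ X) :
    |((fwdDiff (2 : ℕ))^[k] (fun c =>
        (∑ W ∈ shellIn M.2.partner ((univ \ {v, M.2.partner v}) \ {w, M.2.partner w}) (t₀' + 2 * k) c,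
          χ ((W ∩ H).card : ℤ)) /
        ((shellIn M.2.partner ((univ \ {v, M.2.partner v}) \ {w, M.2.partner w}) (t₀' + 2 * k) c).card : ℝ))) c'| ≤
      G * (((m : ℝ) / (4 * ((m : ℝ) - 2))) ^ k * X) := by
  set π := M.2.partner with hπdef
  have hπ : ∀ v, π (π v) = v := partner_partner M
  have hπ' : ∀ v, π v ≠ v := partner_ne M
  have hU : ∀ u ∈ (univ : Finset (Fin n)), π u ∈ (univ : Finset (Fin n)) := fun u _ => mem_univ _
  have hS1 : ∀ u ∈ univ \ {v, π v}, π u ∈ univ \ {v, π v} := sdiff_pair_stable hπ hU v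
  have hS : ∀ u ∈ (univ \ {v, π v}) \ {w, π w}, π u ∈ (univ \ {v, π v}) \ {w, π w} := sdiff_pair_stable hπ hS1 w
  have hScard : ((univ \ {v, π v}) \ {w, π w} : Finset (Fin n)).card + 2 * 2 = n := by
    have h1 := card_sdiff_pair hπ' hU (mem_univ v)
    have h2 := card_sdiff_pair hπ' hS1 hw
    rw [card_univ, Fintype.card_fin] at h1
    omega
  have hne : (shellIn π ((univ \ {v, π v}) \ {w, π w}) (t₀' + 2 * k) (c' + 2 * k)).Nonempty := by
    refine shellIn_sdiff_pair_nonempty_of_half hπ hπ' hS1 hw ?_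
    refine shellIn_sdiff_pair_nonempty_of_full hπ hπ' hU (mem_univ v) ?_ (by omega)
    rw [show t₀' + 2 * k + 1 + 2 = t₀' + 2 * k + 3 by ring, shellIn_univ]
    exact shell_partner_nonempty M ht (by obtain ⟨i, hi⟩ := hc; exact ⟨i + k, by omega⟩) (by omega) (by omega)
  exact abs_fwdDiff_iter_subProfile_le M hS hScard H χ hG0 hG hne hm (by omega) hX0 hX

/-! ### §3 The pinned average identities at a matching on the full ground set -/

/-- **`E_c[χ(X)·n_A]`, pinned**: for an odd cut `t₀+2` and an odd level `c ≤ t₀+2` with `t₀+2+c ≤ n`,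
`E_{Shell_c(M)}[χ(|U∩H|)·n_A(U)] = ((t₀+2−c)/n)·Σ_{v ∈ reps(vAA)} E_{Shell_{[n]∖e_v}(t₀,c)}[χ(|U′∩H|+2)]` (Literature `shellAvg_mul_hhCount_eq`).
[cite: Rothvoss2017, §2 (PDF p. 6)] -/
theorem shellAvg_hhCount_eq (M : PMatch n) (H : Finset (Fin n)) (χ : ℤ → ℝ) {t₀ c : ℕ}
    (ht : Odd (t₀ + 2)) (hc : Odd c) (hct : c ≤ t₀ + 2) (hn : t₀ + 2 + c ≤ n) :
    (∑ U ∈ shell M.2.partner (t₀ + 2) c, χ ((U ∩ H).card : ℤ) *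
        ((((reps M.2.partner (vAA M.2.partner univ H)).filter fun v => v ∈ U ∧ M.2.partner v ∈ U).card : ℕ) : ℝ)) /
        ((shell M.2.partner (t₀ + 2) c).card : ℝ) =
      (((t₀ : ℝ) + 2 - c) / (n : ℝ)) * ∑ v ∈ reps M.2.partner (vAA M.2.partner univ H),
        (∑ U' ∈ shellIn M.2.partner (univ \ {v, M.2.partner v}) t₀ c, χ (((U' ∩ H).card : ℤ) + 2)) /
          ((shellIn M.2.partner (univ \ {v, M.2.partner v}) t₀ c).card : ℝ) := by
  have hπ : ∀ v, M.2.partner (M.2.partner v) = v := partner_partner M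
  have hπ' : ∀ v, M.2.partner v ≠ v := partner_ne M
  have hne : (shellIn M.2.partner univ (t₀ + 2) c).Nonempty := by
    rw [shellIn_univ]; exact shell_partner_nonempty M ht hc hct hn
  have h := shellAvg_mul_hhCount_eq hπ hπ' (S := univ) (fun u _ => mem_univ _) H t₀ c χ hne
  rw [shellIn_univ, card_univ, Fintype.card_fin] at h
  exact h

/-- **`E_c[ψ(X)·n_A(n_A−1)]`, pinned twice**: for an odd cut `t₀+4` and an odd level `c ≤ t₀+4` with `t₀+4+c ≤ n`,
`E_{Shell_c(M)}[ψ(|U∩H|)·n_A(n_A−1)] = ((t₀+4−c)(t₀+2−c)/(n(n−2)))·Σ_{v ∈ reps(vAA)} Σ_{w ∈ reps(vAA)∖{v}} E_{Shell_{[n]∖e_v∖e_w}(t₀,c)}[ψ(|U″∩H|+4)]`.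
[cite: Rothvoss2017, §2 (PDF p. 6)] -/
theorem shellAvg_hhPairs_eq (M : PMatch n) (H : Finset (Fin n)) (ψ : ℤ → ℝ) {t₀ c : ℕ}
    (ht : Odd (t₀ + 4)) (hc : Odd c) (hct : c ≤ t₀ + 4) (hn : t₀ + 4 + c ≤ n) :
    (∑ U ∈ shell M.2.partner (t₀ + 4) c, ψ ((U ∩ H).card : ℤ) *
        (((((reps M.2.partner (vAA M.2.partner univ H)).filter fun v => v ∈ U ∧ M.2.partner v ∈ U).card : ℕ) : ℝ) *
          (((((reps M.2.partner (vAA M.2.partner univ H)).filter fun v => v ∈ U ∧ M.2.partner v ∈ U).card : ℕ) : ℝ) - 1))) /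
        ((shell M.2.partner (t₀ + 4) c).card : ℝ) =
      ((((t₀ : ℝ) + 4 - c) * ((t₀ : ℝ) + 2 - c)) / ((n : ℝ) * ((n : ℝ) - 2))) *
        ∑ v ∈ reps M.2.partner (vAA M.2.partner univ H), ∑ w ∈ (reps M.2.partner (vAA M.2.partner univ H)).erase v,
          (∑ U'' ∈ shellIn M.2.partner (del2 M.2.partner univ v w) t₀ c, ψ (((U'' ∩ H).card : ℤ) + 4)) /
            ((shellIn M.2.partner (del2 M.2.partner univ v w) t₀ c).card : ℝ) := by
  have hπ : ∀ v, M.2.partner (M.2.partner v) = v := partner_partner M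
  have hπ' : ∀ v, M.2.partner v ≠ v := partner_ne M
  have hne : (shellIn M.2.partner univ (t₀ + 4) c).Nonempty := by
    rw [shellIn_univ]; exact shell_partner_nonempty M ht hc hct hn
  have h := shellAvg_mul_hhCount_mul_pred_eq hπ hπ' (S := univ) (fun u _ => mem_univ _) H t₀ c ψ hne
  rw [shellIn_univ, card_univ, Fintype.card_fin] at h
  rw [h, mul_div_assoc]

/-- **`E_c[ψ(X)·n_A·Y]`, pinned once fully and once half** (`Y = |half_M U ∩ H|`): for an odd cut `t₀+3` and an odd level `c₀+1 ≤ t₀+3`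
with `t₀+3+(c₀+1) ≤ n`,
`E_{Shell_{c₀+1}(M)}[ψ(|U∩H|)·n_A(U)·Y(U)] = ((t₀+2−c₀)(c₀+1)/(n(n−2)))·Σ_{v∈reps(vAA)} Σ_{w ∈ ([n]∖e_v)∩H} E_{Shell_{[n]∖e_v∖e_w}(t₀,c₀)}[ψ(|W∩H|+3)]`
— LINEAR IN THE LEVEL, zero at the virtual level (Literature `shellAvg_mul_hhCount_mul_halfCount_eq`). [cite: Rothvoss2017, §2 (PDF p. 6)] -/
theorem shellAvg_hhCount_halfCount_eq (M : PMatch n) (H : Finset (Fin n)) (ψ : ℤ → ℝ) {t₀ c₀ : ℕ}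
    (ht : Odd (t₀ + 3)) (hc : Odd (c₀ + 1)) (hct : c₀ + 1 ≤ t₀ + 3) (hn : t₀ + 3 + (c₀ + 1) ≤ n) :
    (∑ U ∈ shell M.2.partner (t₀ + 3) (c₀ + 1), ψ ((U ∩ H).card : ℤ) *
        ((((reps M.2.partner (vAA M.2.partner univ H)).filter fun v => v ∈ U ∧ M.2.partner v ∈ U).card : ℕ) : ℝ) *
          ((half M.2.partner U ∩ H).card : ℝ)) /
        ((shell M.2.partner (t₀ + 3) (c₀ + 1)).card : ℝ) =
      ((((t₀ : ℝ) + 2 - c₀) * ((c₀ : ℝ) + 1)) / ((n : ℝ) * ((n : ℝ) - 2))) *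
        ∑ v ∈ reps M.2.partner (vAA M.2.partner univ H), ∑ w ∈ (univ \ {v, M.2.partner v}) ∩ H,
          (∑ W ∈ shellIn M.2.partner ((univ \ {v, M.2.partner v}) \ {w, M.2.partner w}) t₀ c₀, ψ (((W ∩ H).card : ℤ) + 3)) /
            ((shellIn M.2.partner ((univ \ {v, M.2.partner v}) \ {w, M.2.partner w}) t₀ c₀).card : ℝ) := by
  have hπ : ∀ v, M.2.partner (M.2.partner v) = v := partner_partner M
  have hπ' : ∀ v, M.2.partner v ≠ v := partner_ne M
  have hne : (shellIn M.2.partner univ (t₀ + 3) (c₀ + 1)).Nonempty := by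
    rw [shellIn_univ]; exact shell_partner_nonempty M ht hc hct hn
  have h := shellAvg_mul_hhCount_mul_halfCount_eq hπ hπ' (S := univ) (fun u _ => mem_univ _) H t₀ c₀ ψ hne
  rw [shellIn_univ, card_univ, Fintype.card_fin] at h
  exact h

end Summit.PneNP.PneNP.Theorems.ChebyshevTracialDesignGammaDirectionTools

end
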